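import Mathlib.MeasureTheory.Measure.Typeclasses.Probability
import Summits.CriticalPhenomena.SAWScalingLimit.Theses.SAWCutPointCondensation

/-!
# Route SAWCutPointCondensation — support item BlobLawDichotomy

The inlined critical blob-time law `(S univ)⁻¹ • S` of a discrete domain is either the zero
measure (total mass `S univ ∈ {0, ∞}`) or a probability measure, for every real blob fugacity
`t` and all `Ω, δ, a, b`.  This is pure `ℝ≥0∞` normalisation algebra: Mathlib's instance
`isZeroOrProbabilityMeasureSMul : IsZeroOrProbabilityMeasure ((μ univ)⁻¹ • μ)` (cases
`μ = 0`, `μ univ = ∞` via `ENNReal.inv_top`, and `ENNReal.inv_mul_cancel` otherwise), read off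
through `eq_zero_or_isProbabilityMeasure`.  (The named form of the same law,
`Literature.Probability.RandomPlanarGeometry.BlobTime.domainLaw`, carries the identical
dichotomy `BlobTime.domainLaw_eq_zero_or_isProbabilityMeasure`; the route item is stated on the
inlined term, which is closed here directly.)
-/

namespace Summit.CriticalPhenomena.SAWScalingLimit.Theorems

open MeasureTheory

/-- **BlobLawDichotomy** (item stmt-CriticalPhenomena-7352 of route SAWCutPointCondensation):
for every real `t` and all `Ω, δ, a, b`, the normalised blob-time law `(S univ)⁻¹ • S` on
`CurveClass ℂ` is `0` or a probability measure — an instance of the generic dichotomy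
`IsZeroOrProbabilityMeasure ((μ univ)⁻¹ • μ)` (Mathlib `isZeroOrProbabilityMeasureSMul`). -/
theorem blobLawDichotomy_proof :
    Summit.CriticalPhenomena.SAWScalingLimit.Theses.SAWCutPointCondensation.BlobLawDichotomy := by
  unfold Summit.CriticalPhenomena.SAWScalingLimit.Theses.SAWCutPointCondensation.BlobLawDichotomy
  intro t Ω δ a b
  beta_reduce
  exact eq_zero_or_isProbabilityMeasure _

end Summit.CriticalPhenomena.SAWScalingLimit.Theorems
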